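import Mathlib
import HarnessLib
import Literature.Computability.AlgebraicComplexity.PatternExpressions

/-!
# Uniqueness of homomorphism expansions at volume `≤ n` (Dwivedi–Pago–Seppelt 2026, Lemma 8.18)

Route MonotoneRestoration, crux `MonotoneRestorationQP` (stmt-ValiantsHypothesis-15886), line `linear-width`
(`Cruxes/MonotoneRestorationQP/Lines/linear-width.md`, "First lemma (attack on the rung)"); also the algebra behind the
informal statement of `OrbitRestorationLinearVolumeQP` (stmt-18294: "hom polynomials of the n-edge patterns without isolated
vertices are linearly independent at order n").

**Theorem** (`homPoly_linearIndependent`).  Let `F_i = (Fin (a i) ⊔ Fin (b i), E i)`, `i < m`, be bipartite multigraph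
patterns WITHOUT ISOLATED VERTICES, pairwise NON-ISOMORPHIC (no pair of bijections of the row- and column-vertices carries
`E i` to `E j`), with at most `n` vertices on each side.  Then their homomorphism polynomials on the `n × n` matrix
(tree `homPoly`, DPS26 eq. (1)) are linearly independent over any field of characteristic `0`:
`Σ_i α_i · hom_{F_i,n} = 0 ⇒ α = 0`.

Proof (leading monomial; DPS26 prove it via injective polynomials and Möbius inversion over quotients): let `i₀` maximise
the number of vertices among the patterns with `α_i ≠ 0` and let `D₀` be the monomial of an INJECTIVE placement of
`F_{i₀}` in the matrix.  The coefficient of `D₀` in `hom_{F,n}` counts the vertex maps `h` pushing `E(F)` forward onto `D₀`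
(`coeff_homPoly`); if one exists and `F` has no isolated vertices then `h` maps the vertex classes of `F` ONTO those of the
placed copy of `F_{i₀}`, so `F` has at least as many vertices on each side, hence (maximality) exactly as many, `h` is a
pair of bijections and `F ≅ F_{i₀}` (`exists_iso_of_map_eq`).  So only `i₀` contributes to the coefficient of `D₀`, which is
`α_{i₀} · N` with `N ≥ 1` — a contradiction.

Honest framing: a helper lemma (typed literature-level algebra) for OPEN items; nothing here is progress on `VP ≠ VNP`.
[cite: DwivediPagoSeppelt2026, Lemma 8.18 (p. 34)]
-/

noncomputable section

open MvPolynomial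

-- `Summit.ValiantsHypothesis.ValiantsHypothesis.…` is the tree's single-conjunct layout (Sub = Summit).
set_option linter.dupNamespace false

namespace Summit.ValiantsHypothesis.ValiantsHypothesis.Theorems

namespace HomExpansionUnique

open Literature.Computability.AlgebraicComplexity

universe u

variable {K : Type*} [Field K]

/-! ### Monomials of a homomorphism polynomial -/

/-- A product of variables is the monomial of the multiset of their indices. [folklore] -/
theorem prod_map_X_eq_monomial {τ σ : Type*} [DecidableEq σ] (f : τ → σ) (M : Multiset τ) :
    (M.map fun t => (X (f t) : MvPolynomial σ K)).prod = monomial (Multiset.toFinsupp (M.map f)) 1 := by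
  induction M using Multiset.induction with
  | empty => simp
  | cons a M ih =>
    rw [Multiset.map_cons, Multiset.prod_cons, ih, Multiset.map_cons, ← Multiset.singleton_add, map_add,
      Multiset.toFinsupp_singleton, X, monomial_mul, one_mul]

/-- **Coefficients of a homomorphism polynomial count vertex maps**: the coefficient of the monomial `D` in
`hom_{F,n}` is the number of pairs of vertex maps `h = (h₁, h₂)` pushing the edge multiset of `F` forward onto `D`.
[cite: DwivediPagoSeppelt2026, eq. (1)] -/
theorem coeff_homPoly {A B : Type u} [Fintype A] [DecidableEq A] [Fintype B] [DecidableEq B]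
    (E : Multiset (A × B)) (n : ℕ) (D : (Fin n × Fin n) →₀ ℕ) :
    coeff D (homPoly E n K) =
      ((Finset.univ.filter fun h : (A → Fin n) × (B → Fin n) =>
          Multiset.toFinsupp ((E.map fun e => (h.1 e.1, h.2 e.2))) = D).card : K) := by
  classical
  unfold homPoly
  rw [coeff_sum]
  simp only [prod_map_X_eq_monomial, coeff_monomial]
  rw [Finset.sum_boole]

/-! ### The combinatorial core: a surjective push-forward between patterns of the same volume is an isomorphism -/

/-- If the edge multiset of a pattern `F = (A ⊔ B, E)` without isolated vertices is pushed forward by vertex maps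
`(h₁, h₂)` EXACTLY onto an injectively placed copy of a pattern `F₀ = (A₀ ⊔ B₀, E₀)` without isolated vertices, and
`F` has at most as many vertices as `F₀`, then `F ≅ F₀`. [cite: DwivediPagoSeppelt2026, Lemma 8.18 (proof)] -/
theorem exists_iso_of_map_eq {A B A₀ B₀ V W : Type*} [Fintype A] [Fintype B] [Fintype A₀] [Fintype B₀]
    (E : Multiset (A × B)) (E₀ : Multiset (A₀ × B₀)) (h₁ : A → V) (h₂ : B → W) (ι : A₀ → V) (κ : B₀ → W)
    (hι : Function.Injective ι) (hκ : Function.Injective κ)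
    (hrow : ∀ u : A, ∃ e ∈ E, e.1 = u) (hcol : ∀ v : B, ∃ e ∈ E, e.2 = v)
    (hrow₀ : ∀ u : A₀, ∃ e ∈ E₀, e.1 = u) (hcol₀ : ∀ v : B₀, ∃ e ∈ E₀, e.2 = v)
    (hcard : Fintype.card A + Fintype.card B ≤ Fintype.card A₀ + Fintype.card B₀)
    (heq : (E.map fun e => (h₁ e.1, h₂ e.2)) = (E₀.map fun e => (ι e.1, κ e.2))) :
    ∃ (ea : A ≃ A₀) (eb : B ≃ B₀), (E.map fun e => (ea e.1, eb e.2)) = E₀ := by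
  classical
  -- every vertex of `F` is mapped into the placed copy of `F₀`
  have hA : ∀ u : A, ∃ u₀ : A₀, ι u₀ = h₁ u := by
    intro u
    obtain ⟨e, he, rfl⟩ := hrow u
    have hm : (h₁ e.1, h₂ e.2) ∈ (E₀.map fun e => (ι e.1, κ e.2)) := by
      rw [← heq]; exact Multiset.mem_map_of_mem _ he
    obtain ⟨e₀, -, he₀⟩ := Multiset.mem_map.1 hm
    exact ⟨e₀.1, (Prod.mk.inj he₀).1⟩
  have hB : ∀ v : B, ∃ v₀ : B₀, κ v₀ = h₂ v := by
    intro v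
    obtain ⟨e, he, rfl⟩ := hcol v
    have hm : (h₁ e.1, h₂ e.2) ∈ (E₀.map fun e => (ι e.1, κ e.2)) := by
      rw [← heq]; exact Multiset.mem_map_of_mem _ he
    obtain ⟨e₀, -, he₀⟩ := Multiset.mem_map.1 hm
    exact ⟨e₀.2, (Prod.mk.inj he₀).2⟩
  -- and every vertex of the placed copy of `F₀` is hit
  have hA₀ : ∀ u₀ : A₀, ∃ u : A, h₁ u = ι u₀ := by
    intro u₀
    obtain ⟨e₀, he₀, rfl⟩ := hrow₀ u₀
    have hm : (ι e₀.1, κ e₀.2) ∈ (E.map fun e => (h₁ e.1, h₂ e.2)) := by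
      rw [heq]; exact Multiset.mem_map_of_mem _ he₀
    obtain ⟨e, -, he⟩ := Multiset.mem_map.1 hm
    exact ⟨e.1, (Prod.mk.inj he).1⟩
  have hB₀ : ∀ v₀ : B₀, ∃ v : B, h₂ v = κ v₀ := by
    intro v₀
    obtain ⟨e₀, he₀, rfl⟩ := hcol₀ v₀
    have hm : (ι e₀.1, κ e₀.2) ∈ (E.map fun e => (h₁ e.1, h₂ e.2)) := by
      rw [heq]; exact Multiset.mem_map_of_mem _ he₀
    obtain ⟨e, -, he⟩ := Multiset.mem_map.1 hm
    exact ⟨e.2, (Prod.mk.inj he).2⟩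
  choose ea hea using hA
  choose eb heb using hB
  -- `ea`, `eb` are surjective, hence bijective by counting
  have hea_surj : Function.Surjective ea := by
    intro u₀
    obtain ⟨u, hu⟩ := hA₀ u₀
    exact ⟨u, hι (by rw [hea u, hu])⟩
  have heb_surj : Function.Surjective eb := by
    intro v₀
    obtain ⟨v, hv⟩ := hB₀ v₀
    exact ⟨v, hκ (by rw [heb v, hv])⟩
  have hcA : Fintype.card A₀ ≤ Fintype.card A := Fintype.card_le_of_surjective ea hea_surj
  have hcB : Fintype.card B₀ ≤ Fintype.card B := Fintype.card_le_of_surjective eb heb_surj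
  have hea_bij : Function.Bijective ea :=
    (Fintype.bijective_iff_surjective_and_card ea).2 ⟨hea_surj, by omega⟩
  have heb_bij : Function.Bijective eb :=
    (Fintype.bijective_iff_surjective_and_card eb).2 ⟨heb_surj, by omega⟩
  refine ⟨Equiv.ofBijective ea hea_bij, Equiv.ofBijective eb heb_bij, ?_⟩
  -- the relabelled pattern is `F₀`: compare after the injective placement
  have hinj : Function.Injective fun e : A₀ × B₀ => (ι e.1, κ e.2) := fun p q hpq => by
    obtain ⟨h1, h2⟩ := Prod.mk.inj hpq
    exact Prod.ext (hι h1) (hκ h2)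
  apply Multiset.map_injective hinj
  rw [← heq]
  simp only [Multiset.map_map, Function.comp_def, Equiv.ofBijective_apply, hea, heb]

/-! ### Linear independence -/

/-- **Uniqueness of homomorphism expansions at volume `≤ n`** (Dwivedi–Pago–Seppelt 2026, Lemma 8.18): the
homomorphism polynomials `hom_{F_i,n}` of pairwise non-isomorphic bipartite multigraph patterns `F_i = (Fin (a i) ⊔
Fin (b i), E i)` without isolated vertices and with `a i, b i ≤ n` are linearly independent over a field of
characteristic zero. [cite: DwivediPagoSeppelt2026, Lemma 8.18 (p. 34)] -/
theorem homPoly_linearIndependent [CharZero K] (n m : ℕ) (a b : Fin m → ℕ)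
    (E : (i : Fin m) → Multiset (Fin (a i) × Fin (b i))) (α : Fin m → K)
    (hle : ∀ i, a i ≤ n ∧ b i ≤ n)
    (hrow : ∀ i (u : Fin (a i)), ∃ e ∈ E i, e.1 = u)
    (hcol : ∀ i (v : Fin (b i)), ∃ e ∈ E i, e.2 = v)
    (hiso : ∀ i j, i ≠ j → ∀ (ea : Fin (a i) ≃ Fin (a j)) (eb : Fin (b i) ≃ Fin (b j)),
      ((E i).map fun e => (ea e.1, eb e.2)) ≠ E j)
    (hsum : ∑ i, C (α i) * homPoly (E i) n K = 0) :
    α = 0 := by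
  classical
  by_contra hα
  -- the patterns with a nonzero coefficient, and one of them with the most vertices
  set S : Finset (Fin m) := Finset.univ.filter fun i => α i ≠ 0 with hS
  have hSne : S.Nonempty := by
    obtain ⟨i, hi⟩ := Function.ne_iff.1 hα
    exact ⟨i, Finset.mem_filter.2 ⟨Finset.mem_univ _, hi⟩⟩
  obtain ⟨i₀, hi₀S, hmax⟩ := S.exists_max_image (fun i => a i + b i) hSne
  have hαi₀ : α i₀ ≠ 0 := (Finset.mem_filter.1 hi₀S).2
  -- the injective placement of `F_{i₀}` and its monomial
  let ι : Fin (a i₀) → Fin n := Fin.castLE (hle i₀).1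
  let κ : Fin (b i₀) → Fin n := Fin.castLE (hle i₀).2
  have hι : Function.Injective ι := Fin.castLE_injective _
  have hκ : Function.Injective κ := Fin.castLE_injective _
  let D₀ : (Fin n × Fin n) →₀ ℕ := Multiset.toFinsupp (((E i₀).map fun e => (ι e.1, κ e.2)))
  -- the coefficient of `D₀` in the vanishing combination
  have hcoeff : ∑ i, α i * ((Finset.univ.filter fun h : (Fin (a i) → Fin n) × (Fin (b i) → Fin n) =>
      Multiset.toFinsupp (((E i).map fun e => (h.1 e.1, h.2 e.2))) = D₀).card : K) = 0 := by
    have := congrArg (coeff D₀) hsum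
    simpa only [coeff_sum, coeff_C_mul, coeff_homPoly, coeff_zero] using this
  -- only `i₀` contributes
  rw [Finset.sum_eq_single i₀] at hcoeff
  · -- and its contribution is nonzero: the placement itself is counted
    have hpos : (Finset.univ.filter fun h : (Fin (a i₀) → Fin n) × (Fin (b i₀) → Fin n) =>
        Multiset.toFinsupp (((E i₀).map fun e => (h.1 e.1, h.2 e.2))) = D₀).card ≠ 0 := by
      rw [← Nat.pos_iff_ne_zero, Finset.card_pos]
      exact ⟨(ι, κ), Finset.mem_filter.2 ⟨Finset.mem_univ _, rfl⟩⟩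
    exact (mul_ne_zero hαi₀ (Nat.cast_ne_zero.2 hpos)) hcoeff
  · -- every other pattern with nonzero coefficient would be isomorphic to `F_{i₀}`
    intro i _ hi
    by_cases hαi : α i = 0
    · rw [hαi, zero_mul]
    have hiS : i ∈ S := Finset.mem_filter.2 ⟨Finset.mem_univ _, hαi⟩
    have hcard : Fintype.card (Fin (a i)) + Fintype.card (Fin (b i)) ≤
        Fintype.card (Fin (a i₀)) + Fintype.card (Fin (b i₀)) := by
      simpa only [Fintype.card_fin] using hmax i hiS
    suffices h0 : (Finset.univ.filter fun h : (Fin (a i) → Fin n) × (Fin (b i) → Fin n) =>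
        Multiset.toFinsupp (((E i).map fun e => (h.1 e.1, h.2 e.2))) = D₀) = ∅ by
      rw [h0, Finset.card_empty, Nat.cast_zero, mul_zero]
    rw [Finset.filter_eq_empty_iff]
    intro h _ hD
    have heq : ((E i).map fun e => (h.1 e.1, h.2 e.2)) = ((E i₀).map fun e => (ι e.1, κ e.2)) := Multiset.toFinsupp.injective hD
    obtain ⟨ea, eb, hE⟩ := exists_iso_of_map_eq (E i) (E i₀) h.1 h.2 ι κ hι hκ (hrow i) (hcol i)
      (hrow i₀) (hcol i₀) hcard heq
    exact hiso i i₀ hi ea eb hE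
  · intro h; exact absurd (Finset.mem_univ i₀) h

end HomExpansionUnique

end Summit.ValiantsHypothesis.ValiantsHypothesis.Theorems

end
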